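/-
PORT-SPLIT (pub-hodgecm2, COR-CM cell; slot b06, BINDER-OWNERS §8): the three definitions of the stage-1 package file
`HodgeCMPerL/HodgeCM/Proofs/PohlmannSpan.lean` (pub-hodgecm HOME/lean, bytes of record md5 649662cd91b3) —
`Universe.sepOp`, `Universe.sepVal`, `Universe.permWeight` — hoisted VERBATIM (docstrings, binders, bodies, fully-qualified
names) into this definition-only file, so that their review (D-0009) runs early and off the critical path of the landing DAG
(HOME/lean/LANDING-DAG.md); the port of the rest of that file (kit #32 `Proofs/PohlmannSpan.lean`, theorems only) imports this
module. No other edit.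
-/
import Summits.HodgeConjecture.CorCM.Geometry.Universe

/-!
# Pohlmann's span theorem — definitions: the separating operator, its eigencharacter, permuted weights

Proof devices of `Summit.HodgeConjecture.CorCM.Universe.pohlmannSpan_holds` (`Proofs/PohlmannSpan.lean`), after Gao–Ullmo,
*J. Inst. Math. Jussieu* 25 (2025) = arXiv:2411.12249, proof of Theorem 3.1 "(Pohlmann)", p. 9 ll. 38–47, with the
`Aut(ℂ/ℚ)`-action on coefficients replaced by a rational operator:

* `Universe.sepOp c Mi k = Σ_i c_i M_i^*` — a RATIONAL endomorphism of `H^k(X, ℚ)` built from factor-wise CM multiplications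
  `M_i`;
* `Universe.sepVal j a c S = Σ_i c_i ∏_{s ∈ S_{j_i}} s(a_i)` — its eigencharacter on the weight `S`;
* `Universe.permWeight P S` — the weight `S` permuted by a permutation `P` of `Hom(F, ℂ)` (`(P • S)_j = P(S_j)`).

Nothing is asserted here.
-/

noncomputable section

open scoped NumberField

namespace Summit.HodgeConjecture.CorCM

namespace Universe

variable {U : Universe}

/-! ### The rational separating operator `T = Σ_i c_i M_i^*` and its eigencharacter -/

section SepOp

variable {ι : Type} [Fintype ι]

/-- `T = Σ_i c_i M_i^*` on `H^k(X, ℚ)`. -/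
def sepOp {X : U.Var} (c : ι → ℕ) (Mi : ι → U.Mor X X) (k : ℕ) : U.Coh X k →ₗ[ℚ] U.Coh X k :=
  ∑ i, (c i : ℚ) • U.pull (Mi i) k

/-- The eigencharacter `λ(S) = Σ_i c_i ∏_{s ∈ S_{j_i}} s(a_i)` of `T` on the weight `S`. -/
def sepVal {F : CMField} {n : ℕ} (j : ι → Fin (n + 1)) (a : ι → 𝓞 F) (c : ι → ℕ)
    (S : Fin (n + 1) → Finset ((F : Type) →+* ℂ)) : ℂ :=
  ∑ i, (c i : ℂ) * ∏ s ∈ S (j i), s (a i : F)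

end SepOp

/-! ### Galois translates of weights -/

section Galois

variable {F : CMField} {n : ℕ}

/-- The action of a permutation of `Hom(F, ℂ)` on weights: `(P • S)_j = P(S_j)`. -/
def permWeight (P : Equiv.Perm ((F : Type) →+* ℂ)) (S : Fin (n + 1) → Finset ((F : Type) →+* ℂ)) :
    Fin (n + 1) → Finset ((F : Type) →+* ℂ) :=
  fun j => (S j).map P.toEmbedding

end Galois

end Universe

end Summit.HodgeConjecture.CorCM

end
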